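import Summits.Ventures.PercRepro.ProfilePointedAutomatic
import Summits.Ventures.PercRepro.ProfilePointedHomogeneous

/-!
# PercRepro — THE SHAPE OF A MINIMAL (Ĉ)-WITNESS (p10, gen 23; `proofs/P10-DIRECTSUM-g23.md` §8)

A MINIMAL WITNESS of the pointed conjecture (Ĉ) is a pointed matroid `(M, p)` at which (Ĉ) fails while (Ĉ) holds at
every pointed matroid on fewer elements (`MinimalWitness`).  The reductions of the record, assembled — each CONDITIONAL
on the named fact `BiIndepDensityLogConcave` (Theorem A) except the first:

* `MinimalWitness.loopless` — `M` has no loop (unconditional; `pointedRowAt_of_loop`);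
* `MinimalWitness.not_coloop` — `M` has no coloop at all: not `p` (gen 13, `pointedRowAt_coloop_of_fact`), not any
  `e ≠ p` (gen 22, `not_pointedRowAt_delete_coloop_of_fact`: the witness would shrink to `M ∖ e`);
* `MinimalWitness.not_parallel` — `M` has no parallel pair at all: none through `p` (gen 13,
  `pointedRow_parallel_of_fact`), none avoiding `p` (`not_pointedRowAt_parallel_pair_of_fact`: the witness would shrink
  to `(M ∖ g) / f` or `(M ∖ f) / g`) — so `M` is SIMPLE;
* `MinimalWitness.not_disjointSum` — `M` is not a direct sum of two matroids with non-empty ground sets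
  (`not_pointedRowAt_disjointSum_of_fact`: the witness would shrink to the summand containing `p`) — so `M` is
  CONNECTED in the direct-sum sense.

Nothing here asserts (Ĉ); nothing here says a witness exists.
-/

open scoped Matroid

namespace PercRepro.Cogirth

open Finset ThmH Skew

variable {α : Type} [DecidableEq α]

/-- **A minimal (Ĉ)-witness**: (Ĉ) fails at `(M, p)`, `p ∈ E`, and holds at every pointed matroid on fewer elements. -/
def MinimalWitness (M : Matroid α) [M.Finite] (p : α) : Prop :=
  p ∈ gr M ∧ ¬ PointedRowAt M p ∧
    ∀ (N : Matroid α) [N.Finite], (gr N).card < (gr M).card → ∀ q ∈ gr N, PointedRowAt N q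

variable {M : Matroid α} [M.Finite] {p : α}

/-- **A minimal witness is loopless** (unconditional). -/
theorem MinimalWitness.loopless (h : MinimalWitness M p) {l : α} (hl : l ∈ gr M) : rk M {l} = 1 := by
  have h1 := rk_singleton_pos_of_not_pointedRowAt h.2.1 hl
  have h2 := rk_le_card (M := M) ({l} : Finset α)
  rw [card_singleton] at h2
  omega

/-- **A minimal witness has no coloop** (CONDITIONAL on the named fact): neither `p` nor any other point. -/
theorem MinimalWitness.not_coloop (hfact : BiIndepDensityLogConcave α) (h : MinimalWitness M p) {e : α}
    (he : e ∈ gr M) : rk M ((gr M).erase e) + 1 ≠ rk M (gr M) := by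
  intro hec
  obtain ⟨hp, hM, hmin⟩ := h
  by_cases hpe : p = e
  · subst hpe
    exact hM (pointedRowAt_coloop_of_fact hfact M hp hec)
  · apply not_pointedRowAt_delete_coloop_of_fact hfact M hp he hpe hec hM
    apply hmin (M ＼ ({e} : Set α))
    · rw [gr_delete', card_erase_of_mem he]
      have := card_pos.2 ⟨e, he⟩
      omega
    · rw [gr_delete']
      exact mem_erase.2 ⟨hpe, hp⟩

/-- **A minimal witness has no parallel pair** (CONDITIONAL on the named fact): it is SIMPLE. -/
theorem MinimalWitness.not_parallel (hfact : BiIndepDensityLogConcave α) (h : MinimalWitness M p) {f g : α}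
    (hf : f ∈ gr M) (hg : g ∈ gr M) (hfg' : f ≠ g) : rk M {f, g} ≠ 1 := by
  intro hfg
  have hf1 := h.loopless hf
  have hg1 := h.loopless hg
  obtain ⟨hp, hM, hmin⟩ := h
  by_cases hpf : p = f
  · subst hpf
    exact hM (fun k hk => pointedRow_parallel_of_fact hfact M hp hg hfg' hf1 hg1 hfg k hk)
  by_cases hpg : p = g
  · subst hpg
    exact hM (fun k hk => pointedRow_parallel_of_fact hfact M hp hf (Ne.symm hfg') hg1 hf1
      (by rw [pair_comm]; exact hfg) k hk)
  have hN1 : (gr ((M ＼ ({g} : Set α)) ／ ({f} : Set α))).card < (gr M).card := by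
    rw [gr_contract', gr_delete', card_erase_of_mem (mem_erase.2 ⟨hfg', hf⟩), card_erase_of_mem hg]
    have := card_pos.2 ⟨g, hg⟩
    omega
  have hN2 : (gr ((M ＼ ({f} : Set α)) ／ ({g} : Set α))).card < (gr M).card := by
    rw [gr_contract', gr_delete', card_erase_of_mem (mem_erase.2 ⟨hfg'.symm, hg⟩), card_erase_of_mem hf]
    have := card_pos.2 ⟨f, hf⟩
    omega
  have hp1 : p ∈ gr ((M ＼ ({g} : Set α)) ／ ({f} : Set α)) := by
    rw [gr_contract', gr_delete']
    exact mem_erase.2 ⟨hpf, mem_erase.2 ⟨hpg, hp⟩⟩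
  have hp2 : p ∈ gr ((M ＼ ({f} : Set α)) ／ ({g} : Set α)) := by
    rw [gr_contract', gr_delete']
    exact mem_erase.2 ⟨hpg, mem_erase.2 ⟨hpf, hp⟩⟩
  rcases not_pointedRowAt_parallel_pair_of_fact hfact M hf hg hfg' hf1 hg1 hfg hpf hpg hM with h1 | h2
  · exact h1 (hmin _ hN1 p hp1)
  · exact h2 (hmin _ hN2 p hp2)

/-- **A minimal witness is not a direct sum with two non-empty parts** (CONDITIONAL on the named fact): it is
connected in the direct-sum sense. -/
theorem MinimalWitness.not_disjointSum (hfact : BiIndepDensityLogConcave α) (h : MinimalWitness M p)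
    {M₁ M₂ : Matroid α} [M₁.Finite] [M₂.Finite] (hd : Disjoint M₁.E M₂.E) (heq : M = M₁.disjointSum M₂ hd) :
    gr M₁ = ∅ ∨ gr M₂ = ∅ := by
  subst heq
  by_contra hne
  rw [not_or] at hne
  obtain ⟨hne1, hne2⟩ := hne
  obtain ⟨hp, hM, hmin⟩ := h
  have hgr : gr (M₁.disjointSum M₂ hd) = gr M₁ ∪ gr M₂ := gr_disjointSum hd
  have hcard : (gr (M₁.disjointSum M₂ hd)).card = (gr M₁).card + (gr M₂).card := by
    rw [hgr, card_union_of_disjoint (disjoint_gr_gr hd)]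
  have h1pos : 0 < (gr M₁).card := card_pos.2 (nonempty_iff_ne_empty.2 hne1)
  have h2pos : 0 < (gr M₂).card := card_pos.2 (nonempty_iff_ne_empty.2 hne2)
  rw [hgr, mem_union] at hp
  rcases hp with hp | hp
  · exact not_pointedRowAt_disjointSum_of_fact hfact hd hp hM (hmin M₁ (by omega) p hp)
  · haveI : (M₂.disjointSum M₁ hd.symm).Finite := disjointSum_finite M₂ M₁ hd.symm
    have hS' : ¬ PointedRowAt (M₂.disjointSum M₁ hd.symm) p :=
      (pointedRowAt_congr (Matroid.disjointSum_comm (h := hd))).not.1 hM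
    exact not_pointedRowAt_disjointSum_of_fact hfact hd.symm hp hS' (hmin M₂ (by omega) p hp)

end PercRepro.Cogirth
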